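import Literature.Computability.MetaComplexity.DepthFregeHalving
import HarnessLib

/-!
# The weak pigeonhole principle for flat relations in bounded depth (`HB.wphp`)

Part 3 of the discharge of `pudlak_ramseyFourPow_depthFrege_upperBound`: the halving step
("some block is low, or every block has an upper element": `HB.caseLow`, `HB.caseUp`,
`HB.step`), the level induction `HB.levels` and the contradiction `HB.wphp : Sq Q (X^32) Γ`
(Maciel–Pitassi–Woods; Krajíček, *Proof Complexity* 2019, proof of Thm. 11.4.7).
All results are proved; no named facts.
-/

namespace Literature.Computability.MetaComplexity

open Complexity Complexity.PropForm

namespace DepthFrege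

open TextbookFrege (disjList disjList_nil disjList_cons conjList conjList_nil conjList_cons)

/-! ### L11. The halving step -/

namespace HB

variable {Q : SPrm} (P : HB Q)

/-- Auxiliary lemma `xdbl` (bounded-depth Frege toolkit / Pudlák–Krajíček construction, see the section header). [cite: Krajicek2019, proof of Thm. 11.4.7] -/
theorem xdbl (i : ℕ) : P.X ^ i + P.X ^ i ≤ P.X ^ (i + 1) := by
  have hX := P.hX2
  rw [pow_succ]
  calc P.X ^ i + P.X ^ i = P.X ^ i * 2 := by ring
    _ ≤ P.X ^ i * P.X := Nat.mul_le_mul_left _ hX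

/-- Auxiliary lemma `xpow_mono` (bounded-depth Frege toolkit / Pudlák–Krajíček construction, see the section header). [cite: Krajicek2019, proof of Thm. 11.4.7] -/
theorem xpow_mono {i j : ℕ} (hij : i ≤ j) : P.X ^ i ≤ P.X ^ j :=
  Nat.pow_le_pow_right (by have := P.hX2; omega) hij

/-- Auxiliary lemma `xconst` (bounded-depth Frege toolkit / Pudlák–Krajíček construction, see the section header). [cite: Krajicek2019, proof of Thm. 11.4.7] -/
theorem xconst (i : ℕ) {c : ℕ} (hc : c ≤ 2 ^ i) : c ≤ P.X ^ i := xb_const i P.hX2 hc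

/-- Virtual totality of `R_w` in the context `¬ good_w`. [cite: Krajicek2019, proof of Thm. 11.4.7] -/
theorem virt_tot {w : List (Option ℕ)} (hw : w.length ≤ P.e) :
    TotR Q (P.X ^ 10) (neg (P.goodW w) :: P.Γ) P.m (P.nB w.length) (P.R w) := by
  have hX := P.hX2
  have h0 := goodElim_tot (Q := Q) (R := P.R w) (m := P.m) (n := P.nB w.length) (r := P.rmax) (Ξ := P.Γ)
    (fun x y => P.length_R_le' hw x y) P.hΓ (P.base_good hw (P.nB_le_h _)).1
    (P.base_good hw (P.nB_le_h _)).2 (fun x _ => (P.base_Tx hw (P.nB_le_h _) x).2)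
    (by
      have := P.hQW; simp only [hbW] at this
      have := Nat.mul_le_mul_right P.rmax (P.nB_le_h w.length)
      unfold rmax at *; omega)
  refine h0.mono ?_
  have h1 : 3 * (P.nB w.length * P.rmax) ≤ P.X ^ 4 := by
    have := Nat.mul_le_mul_right P.rmax (P.nB_le_h w.length)
    have h2 : P.h * P.rmax ≤ P.X ^ 2 := P.hr_le
    have h3 : 3 ≤ P.X ^ 2 := by nlinarith
    calc 3 * (P.nB w.length * P.rmax) ≤ P.X ^ 2 * P.X ^ 2 := Nat.mul_le_mul h3 (this.trans h2)
      _ = P.X ^ 4 := by ring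
  have h2 : 2 * (P.m + P.m * (P.m * (P.nB w.length * (P.rmax * P.rmax)))) ≤ P.X ^ 9 := by
    have := P.comps_le (P.nB_le_h w.length) le_rfl
    have hg := P.gc_le
    calc _ ≤ 2 * P.X ^ 8 := by omega
      _ ≤ P.X * P.X ^ 8 := Nat.mul_le_mul_right _ hX
      _ = P.X ^ 9 := by ring
  have h3 : (6 : ℕ) ≤ P.X ^ 4 := P.xconst 4 (by norm_num)
  have h4 : P.X ^ 4 + P.X ^ 4 ≤ P.X ^ 9 := (P.xdbl 4).trans (P.xpow_mono (by norm_num))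
  have h5 : P.X ^ 9 + P.X ^ 9 ≤ P.X ^ 10 := P.xdbl 9
  omega

/-- Virtual disjointness of `R_w` in the context `¬ good_w`. [cite: Krajicek2019, proof of Thm. 11.4.7] -/
theorem virt_disj {w : List (Option ℕ)} (hw : w.length ≤ P.e) :
    DisjR Q (P.X ^ 10) (neg (P.goodW w) :: P.Γ) P.m (P.nB w.length) (P.R w) := by
  have hX := P.hX2
  have h0 := goodElim_disj (Q := Q) (R := P.R w) (m := P.m) (n := P.nB w.length) (r := P.rmax) (Ξ := P.Γ)
    (fun x y => P.length_R_le' hw x y) P.hΓ (P.base_good hw (P.nB_le_h _)).1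
    (P.base_good hw (P.nB_le_h _)).2 (fun x _ x' _ y _ κ hκ κ' hκ' => (P.base_D hw hκ hκ').2)
    (by have := P.hQW; simp only [hbW] at this; omega)
  refine h0.mono ?_
  have := P.comps_le (P.nB_le_h w.length) le_rfl
  have hg := P.gc_le
  have h4 : (4 : ℕ) ≤ P.X ^ 9 := P.xconst 9 (by norm_num)
  have h5 : P.X ^ 9 + P.X ^ 9 ≤ P.X ^ 10 := P.xdbl 9
  have h6 : P.X ^ 8 + P.X ^ 8 ≤ P.X ^ 9 := P.xdbl 8
  omega

/-- Auxiliary lemma `hW'` (bounded-depth Frege toolkit / Pudlák–Krajíček construction, see the section header). [cite: Krajicek2019, proof of Thm. 11.4.7] -/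
theorem hW' : P.Γ.length + 2 * (P.h + 1) ^ P.e + P.h * P.cG + 4 * (P.h * P.rmax) + 4 * P.h + 20 ≤ Q.W := by
  have := P.hQW; simp only [hbW] at this; unfold rmax; exact this

/-- **Case "block `i` is low"**: then `R_{i w}` is good. [cite: Krajicek2019, proof of Thm. 11.4.7] -/
theorem caseLow {w : List (Option ℕ)} (hℓ : w.length < P.e) {i : ℕ} (hi : i < P.h) :
    Sq Q (P.X ^ 26)
      (neg (P.lowW w i) :: neg (P.goodW w) :: P.Γ ++ [P.goodW (some i :: w)]) := by
  have hX := P.hX2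
  have hw : w.length ≤ P.e := hℓ.le
  have hw1 : (some i :: w).length ≤ P.e := by simp; omega
  have hw1' : w.length + 1 ≤ P.e := by omega
  set n := P.nB w.length with hn
  set half := P.nB (w.length + 1) with hhalf
  have hnh : n = 2 * half := by rw [hn, hhalf]; exact P.nB_succ hℓ
  have hhalf_le : half ≤ P.h := P.nB_le_h _
  have hn_le : n ≤ P.h := P.nB_le_h _
  set Γ' := neg (P.lowW w i) :: neg (P.goodW w) :: P.Γ with hΓ'
  have hR' : P.R (some i :: w) = compose (atomBi P.G P.h i) (P.R w) id (List.range P.m) := rfl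
  have hbl := P.base_low hw hn_le (half := half) i
  have hbg := P.base_good hw hn_le
  have hΓ'b : ∀ A ∈ Γ', Base Q A := by
    intro A hA
    simp only [hΓ', List.mem_cons] at hA
    rcases hA with rfl | rfl | hA
    · exact hbl.2
    · exact hbg.2
    · exact P.hΓ A hA
  have hW := P.hW'
  have hm : 0 < P.m := Nat.mul_pos P.one_le_h P.one_le_h
  -- (1) disjointness of the new relation
  have hDisjNew : DisjR Q (P.X ^ 10 + 1 + 6) Γ' P.m half (P.R (some i :: w)) := by
    rw [hR']
    refine disjR_compose (t := P.X ^ 10 + 1) ?_ ?_ ?_ (by simp [hΓ']; omega)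
    · intro x hx x' hx' hne v _ α hα α' hα'
      simp only [atomBi] at hα hα'
      split_ifs at hα hα' with hv
      · have hvh : v % P.h < P.h := Nat.mod_lt _ P.one_le_h
        have h1 := P.hDisj x hx x' hx' hne (v % P.h) hvh α hα α' hα'
        refine (h1.weaken₂ (neg α :: neg α' :: Γ') ?_ ?_ ?_).mono ?_
        · intro C hC; simp only [List.mem_cons, hΓ'] at hC ⊢; tauto
        · intro C hC; simp only [List.mem_cons, hΓ'] at hC ⊢
          rcases hC with rfl | rfl | rfl | rfl | hC
          · exact Or.inl (Or.inl rfl)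
          · exact Or.inl (Or.inr (Or.inl rfl))
          · exact Or.inr hbl.2
          · exact Or.inr hbg.2
          · exact Or.inl (Or.inr (Or.inr hC))
        · simp [hΓ']; omega
        · have := P.hXt; have := xb_self hX 10 (by norm_num); omega
      · simp at hα
    · intro v hv v' hv' hne y hy κ hκ κ' hκ'
      have hyn : y < P.nB w.length := by rw [← hn]; omega
      have h1 := P.virt_disj hw v (List.mem_range.1 hv) v' (List.mem_range.1 hv') hne y hyn κ hκ κ' hκ'
      refine (h1.weaken₂ (neg κ :: neg κ' :: Γ') ?_ ?_ ?_).mono le_rfl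
      · intro C hC; simp only [List.mem_cons, hΓ'] at hC ⊢; tauto
      · intro C hC; simp only [List.mem_cons, hΓ'] at hC ⊢
        rcases hC with rfl | rfl | rfl | rfl | hC
        · exact Or.inl (Or.inl rfl)
        · exact Or.inl (Or.inr (Or.inl rfl))
        · exact Or.inr hbl.2
        · exact Or.inl (Or.inr (Or.inr (Or.inl rfl)))
        · exact Or.inl (Or.inr (Or.inr (Or.inr hC)))
      · simp [hΓ']; omega
    · intro x _ y _ χ hχ
      exact (P.base_chain hw1 (x := x) (y := y) (by rw [hR']; exact hχ)).2.1
  -- (2) totality of the new relation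
  have hlc := P.lc_le
  have hhr := P.hr_le
  have hhc := P.hc_le
  have hTotNew : TotR Q (P.X ^ 15) Γ' P.m half (P.R (some i :: w)) := by
    intro x hx
    rw [hR']
    set Vx := (List.range P.h).map (fun p => i * P.h + p) with hVx
    have hVxm : ∀ v ∈ Vx, v ∈ List.range P.m := by
      intro v hv
      simp only [hVx, List.mem_map, List.mem_range] at hv
      obtain ⟨p, hp, rfl⟩ := hv
      rw [List.mem_range]
      calc i * P.h + p < i * P.h + P.h := by omega
        _ = (i + 1) * P.h := by ring
        _ ≤ P.h * P.h := Nat.mul_le_mul_right _ hi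
    have hdiv : ∀ p < P.h, (i * P.h + p) / P.h = i := by
      intro p hp
      rw [Nat.add_comm, Nat.add_mul_div_right _ _ P.one_le_h, Nat.div_eq_of_lt hp]; simp
    have hmod : ∀ p < P.h, (i * P.h + p) % P.h = p := by
      intro p hp
      rw [Nat.add_comm, Nat.add_mul_mod_self_right, Nat.mod_eq_of_lt hp]
    -- the tick used for both inputs of `tot_compose`
    set t₂ := P.X ^ 10 + 1 + P.h * P.rmax * (2 * P.lc + 4) with ht₂
    have ht₂X : t₂ ≤ P.X ^ 11 := by
      have a : 2 * P.lc + 4 ≤ P.X ^ 5 := by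
        have := P.xconst 3 (c := 4) (by norm_num)
        have : P.X ^ 3 + P.X ^ 3 ≤ P.X ^ 4 := P.xdbl 3
        have : P.X ^ 4 + P.X ^ 4 ≤ P.X ^ 5 := P.xdbl 4
        have : P.X ^ 3 ≤ P.X ^ 4 := P.xpow_mono (by norm_num)
        omega
      have b : P.h * P.rmax * (2 * P.lc + 4) ≤ P.X ^ 7 := xb_mul hhr a
      have c : P.X ^ 7 + 1 ≤ P.X ^ 10 := by
        have := P.xpow_mono (show 7 ≤ 9 from by norm_num)
        have : 1 ≤ P.X ^ 9 := Nat.one_le_pow _ _ (by omega)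
        have : P.X ^ 9 + P.X ^ 9 ≤ P.X ^ 10 := P.xdbl 9
        omega
      have : P.X ^ 10 + P.X ^ 10 ≤ P.X ^ 11 := P.xdbl 10
      omega
    -- atoms
    have hA : Sq Q t₂ (Γ' ++ Vx.flatMap (atomBi P.G P.h i x)) := by
      refine ((P.hTot x hx).weaken₂ _ ?_ ?_ ?_).mono ?_
      · intro C hC
        simp only [List.mem_append, List.mem_flatMap, List.mem_range, hΓ', List.mem_cons] at hC ⊢
        rcases hC with hC | ⟨p, hp, hC⟩
        · exact Or.inl (Or.inr (Or.inr hC))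
        · refine Or.inr ⟨i * P.h + p, ?_, ?_⟩
          · simp only [hVx, List.mem_map, List.mem_range]; exact ⟨p, hp, rfl⟩
          · simp only [atomBi, hdiv p hp, if_true, hmod p hp]; exact hC
      · intro C hC
        simp only [List.mem_append, hΓ', List.mem_cons, List.mem_flatMap] at hC
        rcases hC with (rfl | rfl | hC) | ⟨v, _, hC⟩
        · exact Or.inr hbl.2
        · exact Or.inr hbg.2
        · exact Or.inl (by simp [hC])
        · simp only [atomBi] at hC
          split_ifs at hC
          · exact Or.inr (P.base_G hC).1
          · simp at hC
      · have l1 := length_flatMap_le Vx (atomBi P.G P.h i x) P.cG (fun v _ => by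
          unfold atomBi; split_ifs <;> simp [P.hcG])
        simp only [hVx, List.length_map, List.length_range] at l1
        simp only [List.length_append, hΓ', List.length_cons, hVx]
        omega
      · have := P.hXt; have := P.xpow_mono (show 1 ≤ 10 from by norm_num); simp at this; omega
    -- old totality trimmed to the lower half, using `¬ low`
    have hO : ∀ v ∈ Vx, Sq Q t₂ (Γ' ++ (List.range half).flatMap (fun y => P.R w v (id y))) := by
      intro v hv
      simp only [hVx, List.mem_map, List.mem_range] at hv
      obtain ⟨p, hp, rfl⟩ := hv
      have hvm : i * P.h + p < P.m := List.mem_range.1 (hVxm _ (by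
        simp only [hVx, List.mem_map, List.mem_range]; exact ⟨p, hp, rfl⟩))
      have v0 := P.virt_tot hw (i * P.h + p) hvm
      set Up := ((List.range n).filter fun y => half ≤ y).flatMap (P.R w (i * P.h + p)) with hUp
      set Lo := (List.range half).flatMap (P.R w (i * P.h + p)) with hLo
      have hUpB : ∀ C ∈ Up, Base Q C ∧ Base Q (neg C) ∧ Base Q (neg (neg C)) := by
        intro C hC
        simp only [hUp, List.mem_flatMap, List.mem_filter, List.mem_range] at hC
        obtain ⟨y, _, hC⟩ := hC
        exact P.base_chain hw hC
      have hLoB : ∀ C ∈ Lo, Base Q C := by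
        intro C hC
        simp only [hLo, List.mem_flatMap, List.mem_range] at hC
        obtain ⟨y, _, hC⟩ := hC
        exact (P.base_chain hw hC).1
      have hUpl : Up.length ≤ P.h * P.rmax := by
        refine (length_flatMap_le _ _ P.rmax fun y _ => P.length_R_le' hw _ _).trans ?_
        refine Nat.mul_le_mul_right _ ((List.length_filter_le _ _).trans ?_)
        simpa using hn_le
      have hLol : Lo.length ≤ P.h * P.rmax := by
        refine (length_flatMap_le _ _ P.rmax fun y _ => P.length_R_le' hw _ _).trans ?_
        exact Nat.mul_le_mul_right _ (by simpa using hhalf_le)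
      have s1 : Sq Q (P.X ^ 10 + 1) (Up ++ (Γ' ++ Lo)) := by
        refine v0.weaken₂ _ ?_ ?_ ?_
        · intro C hC
          simp only [List.mem_cons, List.mem_append, List.mem_flatMap, List.mem_range] at hC
          simp only [List.mem_append, hΓ', List.mem_cons]
          rcases hC with (rfl | hC) | ⟨y, hy, hC⟩
          · exact Or.inr (Or.inl (Or.inr (Or.inl rfl)))
          · exact Or.inr (Or.inl (Or.inr (Or.inr hC)))
          · by_cases hyh : half ≤ y
            · left
              simp only [hUp, List.mem_flatMap, List.mem_filter, List.mem_range, decide_eq_true_eq]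
              exact ⟨y, ⟨by rw [hn]; exact hy, hyh⟩, hC⟩
            · right; right
              simp only [hLo, List.mem_flatMap, List.mem_range]
              exact ⟨y, by omega, hC⟩
        · intro C hC
          simp only [List.mem_append, hΓ', List.mem_cons] at hC
          rcases hC with hC | (rfl | rfl | hC) | hC
          · exact Or.inr (hUpB C hC).1
          · exact Or.inr hbl.2
          · exact Or.inl (by simp)
          · exact Or.inl (by simp [hC])
          · exact Or.inr (hLoB C hC)
        · simp only [List.length_append, hΓ', List.length_cons]; omega
      have s2 := Sq.multiCut Up s1 (t' := 2 * P.lc + 2) (by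
        intro κ hκUp
        have hκUp' := hκUp
        simp only [hUp, List.mem_flatMap, List.mem_filter, List.mem_range, decide_eq_true_eq] at hκUp'
        obtain ⟨y, ⟨hyn, hyh⟩, hκ⟩ := hκUp'
        have hbκ := hUpB κ hκUp
        have a0 : Sq Q 1 (neg (neg κ) :: neg κ :: (neg (P.goodW w) :: P.Γ ++ Lo)) := by
          refine Sq.ax (A := neg κ) ?_ ?_ (by simp) (by simp)
          · intro C hC
            simp only [List.mem_cons, List.mem_append] at hC
            rcases hC with rfl | rfl | (rfl | hC) | hC
            · exact hbκ.2.2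
            · exact hbκ.2.1
            · exact hbg.2
            · exact P.hΓ C hC
            · exact hLoB C hC
          · simp only [List.length_cons, List.length_append]; omega
        have hmem : neg κ ∈ lowList (P.R w) P.h n half i :=
          mem_lowList.2 ⟨p, hp, y, hyh, hyn, κ, hκ, rfl⟩
        have a1 := Sq.negAndOfMem (L := neg κ :: (neg (P.goodW w) :: P.Γ ++ Lo))
          (by simp only [List.length_cons, List.length_append]; omega)
          (lowList (P.R w) P.h n half i) hmem hbl.2 a0
        have a2 := a1.swap
        refine a2.mono ?_
        have := length_lowList_le (h := P.h) (n := n) (half := half) (i := i)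
          (fun x y => P.length_R_le' hw x y)
        have := P.lows_le hn_le le_rfl
        omega)
      refine s2.mono ?_
      rw [ht₂]
      have := Nat.mul_le_mul hUpl (le_refl (2 * P.lc + 2 + 2))
      rw [show 2 * P.lc + 2 + 2 = 2 * P.lc + 4 from rfl] at this ⊢
      omega
    have hmain := tot_compose (Q := Q) (Γ := Γ') (Atom := atomBi P.G P.h i) (Old := P.R w) (τ := id)
      (V := List.range P.m) (Vx := Vx) (x := x) (n := half) (Wv := P.h * P.rmax) (t := t₂) hVxm hA hO
      (fun v _ => by
        refine (length_flatMap_le _ _ P.rmax fun y _ => P.length_R_le' hw _ _).trans ?_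
        exact Nat.mul_le_mul_right _ (by simpa using hhalf_le))
      (fun y _ χ hχ => (P.base_chain hw1 (x := x) (y := y) (by rw [hR']; exact hχ)).1)
      (fun v _ α hα => by
        simp only [atomBi] at hα
        split_ifs at hα
        · exact (P.base_G hα).2.1
        · simp at hα)
      (fun v _ y _ κ hκ => (P.base_chain hw hκ).2.1)
      (by
        have l1 := length_flatMap_le Vx (atomBi P.G P.h i x) P.cG (fun v _ => by
          unfold atomBi; split_ifs <;> simp [P.hcG])
        have l2 := length_flatMap_le (List.range half)
          (compose (atomBi P.G P.h i) (P.R w) id (List.range P.m) x) P.rmax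
          (fun y _ => by rw [← hR']; exact P.length_R_le' hw1 x y)
        simp only [hVx, List.length_map, List.length_range] at l1 l2
        simp only [hΓ', List.length_cons, hVx]
        have := Nat.mul_le_mul_right P.rmax hhalf_le
        omega)
    refine hmain.mono ?_
    have l1 := length_flatMap_le Vx (atomBi P.G P.h i x) P.cG (fun v _ => by
      unfold atomBi; split_ifs <;> simp [P.hcG])
    have hVxl : Vx.length = P.h := by simp [hVx]
    rw [hVxl] at l1
    have a : t₂ + 6 * (P.h * P.rmax) + 3 ≤ P.X ^ 12 := by
      have : 6 * (P.h * P.rmax) + 3 ≤ P.X ^ 5 := by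
        have := P.xconst 2 (c := 3) (by norm_num)
        have : P.X ^ 2 + P.X ^ 2 ≤ P.X ^ 3 := P.xdbl 2
        have : P.X ^ 3 + P.X ^ 3 ≤ P.X ^ 4 := P.xdbl 3
        have : P.X ^ 4 + P.X ^ 4 ≤ P.X ^ 5 := P.xdbl 4
        omega
      have : P.X ^ 5 ≤ P.X ^ 11 := P.xpow_mono (by norm_num)
      have : P.X ^ 11 + P.X ^ 11 ≤ P.X ^ 12 := P.xdbl 11
      omega
    have b : (Vx.flatMap (atomBi P.G P.h i x)).length * (t₂ + 6 * (P.h * P.rmax) + 3) ≤ P.X ^ 14 := by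
      calc _ ≤ (P.h * P.cG) * P.X ^ 12 := Nat.mul_le_mul l1 a
        _ ≤ P.X ^ 2 * P.X ^ 12 := Nat.mul_le_mul_right _ hhc
        _ = P.X ^ 14 := by ring
    have : P.X ^ 11 + 1 ≤ P.X ^ 14 := by
      have : P.X ^ 11 ≤ P.X ^ 13 := P.xpow_mono (by norm_num)
      have : 1 ≤ P.X ^ 13 := Nat.one_le_pow _ _ (by omega)
      have : P.X ^ 13 + P.X ^ 13 ≤ P.X ^ 14 := P.xdbl 13
      omega
    have : P.X ^ 14 + P.X ^ 14 ≤ P.X ^ 15 := P.xdbl 14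
    omega
  -- (3) goodness of the new relation
  have hg := goodIntro (Q := Q) (R := P.R (some i :: w)) (m := P.m) (n := half)
    (r := rB P.h P.cG (w.length + 1)) (t := P.X ^ 15) (Γ' := Γ') hTotNew
    (hDisjNew.mono (by
      have : P.X ^ 10 ≤ P.X ^ 14 := P.xpow_mono (by norm_num)
      have : 7 ≤ P.X ^ 14 := P.xconst 14 (by norm_num)
      have : P.X ^ 14 + P.X ^ 14 ≤ P.X ^ 15 := P.xdbl 14
      omega))
    (fun x y => by simpa using P.length_R_le (some i :: w) x y) hΓ'b
    (by simpa [goodW] using (P.base_good hw1 hhalf_le).1)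
    (by
      simp only [hΓ', List.length_cons]
      have := Nat.mul_le_mul hhalf_le (P.rB_le_rmax hw1')
      omega)
  have hg' := hg.weaken₂ (Γ' ++ [P.goodW (some i :: w)])
    (by
      intro C hC; simp only [List.mem_cons] at hC; simp only [List.mem_append, List.mem_singleton, goodW,
        List.length_cons]
      rcases hC with rfl | hC
      · exact Or.inr rfl
      · exact Or.inl hC)
    (by
      intro C hC
      simp only [List.mem_append, List.mem_singleton, goodW, List.length_cons] at hC
      simp only [List.mem_cons]
      rcases hC with hC | rfl
      · exact Or.inl (Or.inr hC)
      · exact Or.inl (Or.inl rfl))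
    (by simp only [List.length_append, hΓ', List.length_cons, List.length_nil]; omega)
  refine (show Sq Q _ (neg (P.lowW w i) :: neg (P.goodW w) :: P.Γ ++ [P.goodW (some i :: w)]) from hg').mono ?_
  -- ticks
  have c1 := P.comps_le hhalf_le (P.rB_le_rmax hw1')
  have c2 : P.X ^ 15 + 3 * (half * rB P.h P.cG (w.length + 1)) + 4 ≤ P.X ^ 16 := by
    have := Nat.mul_le_mul hhalf_le (P.rB_le_rmax hw1')
    have : 3 * (P.h * P.rmax) + 4 ≤ P.X ^ 5 := by
      have := P.xconst 2 (c := 4) (by norm_num)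
      have : P.X ^ 2 + P.X ^ 2 ≤ P.X ^ 3 := P.xdbl 2
      have : P.X ^ 3 + P.X ^ 3 ≤ P.X ^ 4 := P.xdbl 3
      have : P.X ^ 4 + P.X ^ 4 ≤ P.X ^ 5 := P.xdbl 4
      omega
    have : P.X ^ 5 ≤ P.X ^ 15 := P.xpow_mono (by norm_num)
    have : P.X ^ 15 + P.X ^ 15 ≤ P.X ^ 16 := P.xdbl 15
    omega
  have c3 : (P.m + P.m * (P.m * (half * (rB P.h P.cG (w.length + 1) * rB P.h P.cG (w.length + 1))))) *
      (P.X ^ 15 + 3 * (half * rB P.h P.cG (w.length + 1)) + 4) ≤ P.X ^ 24 := by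
    calc _ ≤ P.gc * P.X ^ 16 := Nat.mul_le_mul c1 c2
      _ ≤ P.X ^ 8 * P.X ^ 16 := Nat.mul_le_mul_right _ P.gc_le
      _ = P.X ^ 24 := by ring
  have : P.X ^ 24 ≤ P.X ^ 25 := P.xpow_mono (by norm_num)
  have : 2 ≤ P.X ^ 25 := P.xconst 25 (by norm_num)
  have : P.X ^ 25 + P.X ^ 25 ≤ P.X ^ 26 := P.xdbl 25
  omega

/-- **Case "every block has an upper element"**: then `R_{* w}` is good (or some block is
low). [cite: Krajicek2019, proof of Thm. 11.4.7] -/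
theorem caseUp {w : List (Option ℕ)} (hℓ : w.length < P.e) :
    Sq Q (P.X ^ 22)
      ((neg (P.goodW w) :: P.Γ) ++ (List.range P.h).map (P.lowW w) ++ [P.goodW (none :: w)]) := by
  have hX := P.hX2
  have hw : w.length ≤ P.e := hℓ.le
  have hw1 : (none :: w).length ≤ P.e := by simp; omega
  have hw1' : w.length + 1 ≤ P.e := by omega
  set n := P.nB w.length with hn
  set half := P.nB (w.length + 1) with hhalf
  have hnh : n = 2 * half := by rw [hn, hhalf]; exact P.nB_succ hℓ
  have hhalf_le : half ≤ P.h := P.nB_le_h _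
  have hn_le : n ≤ P.h := P.nB_le_h _
  have hhalf' : 2 ^ (P.e - w.length - 1) = half := by
    rw [hhalf]; simp only [HB.nB, Nat.sub_sub]
  set Γ'' := (neg (P.goodW w) :: P.Γ) ++ (List.range P.h).map (P.lowW w) with hΓ''
  have hRs : P.R (none :: w) =
      compose (atomBs P.G P.h) (P.R w) (fun y => y + 2 ^ (P.e - w.length - 1)) (List.range P.m) := rfl
  have hbg := P.base_good hw hn_le
  have hbl : ∀ i, Base Q (P.lowW w i) ∧ Base Q (neg (P.lowW w i)) := fun i =>
    P.base_low hw hn_le (half := half) i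
  have hΓ''b : ∀ A ∈ Γ'', Base Q A := by
    intro A hA
    simp only [hΓ'', List.mem_append, List.mem_cons, List.mem_map, List.mem_range] at hA
    rcases hA with (rfl | hA) | ⟨i, _, rfl⟩
    · exact hbg.2
    · exact P.hΓ A hA
    · exact (hbl i).1
  have hΓ''l : Γ''.length = P.Γ.length + 1 + P.h := by
    simp [hΓ'']; omega
  have hW := P.hW'
  have hm : 0 < P.m := Nat.mul_pos P.one_le_h P.one_le_h
  have hlc := P.lc_le
  have hhr := P.hr_le
  have hhc := P.hc_le
  -- (1) disjointness of the new relation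
  have hDisjNew : DisjR Q (P.X ^ 10 + 1 + 6) Γ'' P.m half (P.R (none :: w)) := by
    rw [hRs]
    refine disjR_compose (t := P.X ^ 10 + 1) ?_ ?_ ?_ (by rw [hΓ''l]; omega)
    · intro x hx x' hx' hne v hv α hα α' hα'
      simp only [atomBs] at hα hα'
      have hvh : v / P.h < P.h := by
        rw [Nat.div_lt_iff_lt_mul P.one_le_h]; exact List.mem_range.1 hv
      have h1 := P.hDisj x hx x' hx' hne (v / P.h) hvh α hα α' hα'
      refine (h1.weaken₂ (neg α :: neg α' :: Γ'') ?_ ?_ ?_).mono ?_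
      · intro C hC; simp only [List.mem_cons, hΓ'', List.mem_append] at hC ⊢; tauto
      · intro C hC
        simp only [List.mem_cons] at hC
        rcases hC with rfl | rfl | hC
        · exact Or.inl (by simp)
        · exact Or.inl (by simp)
        · exact Or.inr (hΓ''b C hC)
      · simp only [List.length_cons, hΓ''l]; omega
      · have := P.hXt; have := xb_self hX 10 (by norm_num); omega
    · intro v hv v' hv' hne y hy κ hκ κ' hκ'
      rw [hhalf'] at hκ hκ'
      have hyn : y + half < P.nB w.length := by rw [← hn]; omega
      have h1 := P.virt_disj hw v (List.mem_range.1 hv) v' (List.mem_range.1 hv') hne (y + half) hyn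
        κ hκ κ' hκ'
      refine (h1.weaken₂ (neg κ :: neg κ' :: Γ'') ?_ ?_ ?_).mono le_rfl
      · intro C hC; simp only [List.mem_cons, hΓ'', List.mem_append] at hC ⊢; tauto
      · intro C hC
        simp only [List.mem_cons] at hC
        rcases hC with rfl | rfl | hC
        · exact Or.inl (by simp)
        · exact Or.inl (by simp)
        · exact Or.inr (hΓ''b C hC)
      · simp only [List.length_cons, hΓ''l]; omega
    · intro x _ y _ χ hχ
      exact (P.base_chain hw1 (x := x) (y := y) (by rw [hRs]; exact hχ)).2.1
  -- (2) totality of the new relation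
  have hdiv : ∀ b < P.h, ∀ p < P.h, (b * P.h + p) / P.h = b := by
    intro b _ p hp
    rw [Nat.add_comm, Nat.add_mul_div_right _ _ P.one_le_h, Nat.div_eq_of_lt hp]; simp
  have hTotNew : TotR Q (P.X ^ 9) Γ'' P.m half (P.R (none :: w)) := by
    intro x hx
    rw [hRs]
    set Tg := (List.range half).flatMap
      (compose (atomBs P.G P.h) (P.R w) (fun y => y + 2 ^ (P.e - w.length - 1)) (List.range P.m) x)
      with hTg
    have hTgB : ∀ C ∈ Tg, Base Q C := by
      intro C hC
      simp only [hTg, List.mem_flatMap, List.mem_range] at hC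
      obtain ⟨y, _, hC⟩ := hC
      exact (P.base_chain hw1 (x := x) (y := y) (by rw [hRs]; exact hC)).1
    have hTgl : Tg.length ≤ P.h * P.rmax := by
      refine (length_flatMap_le _ _ P.rmax fun y _ => ?_).trans (Nat.mul_le_mul_right _ (by simpa using hhalf_le))
      rw [← hRs]; exact P.length_R_le' hw1 x y
    set Gx := (List.range P.h).flatMap (P.G x) with hGx
    have hGxl : Gx.length ≤ P.h * P.cG :=
      (length_flatMap_le _ _ P.cG fun b _ => P.hcG x b).trans (by simp)
    have s1 : Sq Q (P.tG + 1) (Gx ++ (Γ'' ++ Tg)) := by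
      refine (P.hTot x hx).weaken₂ _ ?_ ?_ ?_
      · intro C hC; simp only [List.mem_append, hΓ'', List.mem_cons] at hC ⊢; tauto
      · intro C hC
        simp only [List.mem_append] at hC
        rcases hC with hC | hC | hC
        · exact Or.inl (List.mem_append_right _ hC)
        · exact Or.inr (hΓ''b C hC)
        · exact Or.inr (hTgB C hC)
      · simp only [List.length_append, hΓ''l]; omega
    have s2 := Sq.multiCut Gx s1 (t' := 5 * P.lc + 2) (by
      intro g hg
      have hg' := hg
      simp only [hGx, List.mem_flatMap, List.mem_range] at hg'
      obtain ⟨b, hb, hgb⟩ := hg'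
      have hbg' := P.base_G hgb
      set Lg := neg g :: (Γ'' ++ Tg) with hLg
      have hLgB : ∀ C ∈ Lg, Base Q C := by
        intro C hC
        simp only [hLg, List.mem_cons, List.mem_append] at hC
        rcases hC with rfl | hC | hC
        · exact hbg'.2.1
        · exact hΓ''b C hC
        · exact hTgB C hC
      have hmemTg : ∀ p < P.h, ∀ y, half ≤ y → y < n → ∀ κ ∈ P.R w (b * P.h + p) y, conj g κ ∈ Tg := by
        intro p hp y hy1 hy2 κ hκ
        simp only [hTg, List.mem_flatMap, List.mem_range]
        refine ⟨y - half, by omega, mem_compose.2 ⟨b * P.h + p, ?_, g, ?_, κ, ?_, rfl⟩⟩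
        · rw [List.mem_range]
          calc b * P.h + p < b * P.h + P.h := by omega
            _ = (b + 1) * P.h := by ring
            _ ≤ P.h * P.h := Nat.mul_le_mul_right _ hb
        · simp only [atomBs, hdiv b hb p hp]; exact hgb
        · rw [hhalf', show y - half + half = y from by omega]; exact hκ
      have a1 := Sq.andIntro (L := Lg) hLgB (by simp only [hLg, List.length_cons, List.length_append, hΓ''l]; omega)
        (lowList (P.R w) P.h n half b) (hbl b).1 (t := 4) (by
          intro A hA
          obtain ⟨p, hp, y, hy1, hy2, κ, hκ, rfl⟩ := mem_lowList.1 hA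
          have hbκ := P.base_chain hw hκ
          refine Sq.conjParts (L := neg κ :: Lg) (A := g) (B := κ) ?_ ?_ (by simp [hLg]) (by simp)
            (by simp only [List.mem_cons, hLg, List.mem_append]; exact Or.inr (Or.inr (Or.inr (hmemTg p hp y hy1 hy2 κ hκ))))
          · intro C hC
            simp only [List.mem_cons] at hC
            rcases hC with rfl | hC
            · exact hbκ.2.1
            · exact hLgB C hC
          · simp only [List.length_cons, hLg, List.length_append, hΓ''l]; omega)
      have hlowmem : conjList (lowList (P.R w) P.h n half b) ∈ Lg := by
        simp only [hLg, List.mem_cons, hΓ'', List.mem_append, List.mem_map, List.mem_range]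
        exact Or.inr (Or.inl (Or.inr ⟨b, hb, rfl⟩))
      have a2 := a1.weaken₂ Lg (by
          intro C hC; simp only [List.mem_cons] at hC
          rcases hC with rfl | hC
          · exact hlowmem
          · exact hC) (fun C hC => Or.inr (hLgB C hC))
        (by simp only [hLg, List.length_cons, List.length_append, hΓ''l]; omega)
      refine a2.mono ?_
      have := length_lowList_le (h := P.h) (n := n) (half := half) (i := b) (fun x y => P.length_R_le' hw x y)
      have := P.lows_le hn_le le_rfl
      omega)
    refine s2.mono ?_
    have a : 5 * P.lc + 2 + 2 ≤ P.X ^ 6 := by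
      have : 8 ≤ P.X ^ 3 := P.xconst 3 (by norm_num)
      have : P.X ^ 3 * P.X ^ 3 = P.X ^ 6 := by ring
      nlinarith
    have b : Gx.length * (5 * P.lc + 2 + 2) ≤ P.X ^ 8 := by
      calc _ ≤ P.X ^ 2 * P.X ^ 6 := Nat.mul_le_mul (hGxl.trans hhc) a
        _ = P.X ^ 8 := by ring
    have := P.hXt
    have : P.X + 1 ≤ P.X ^ 8 := by
      have := xb_self hX 7 (by norm_num); have : 1 ≤ P.X ^ 7 := Nat.one_le_pow _ _ (by omega)
      have : P.X ^ 7 + P.X ^ 7 ≤ P.X ^ 8 := P.xdbl 7; omega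
    have : P.X ^ 8 + P.X ^ 8 ≤ P.X ^ 9 := P.xdbl 8
    omega
  -- (3) goodness of the new relation
  have hg := goodIntro (Q := Q) (R := P.R (none :: w)) (m := P.m) (n := half)
    (r := rB P.h P.cG (w.length + 1)) (t := P.X ^ 11) (Γ' := Γ'') (hTotNew.mono (P.xpow_mono (by norm_num)))
    (hDisjNew.mono (by
      have : P.X ^ 10 ≤ P.X ^ 10 := le_rfl
      have : 7 ≤ P.X ^ 10 := P.xconst 10 (by norm_num)
      have : P.X ^ 10 + P.X ^ 10 ≤ P.X ^ 11 := P.xdbl 10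
      omega))
    (fun x y => by simpa using P.length_R_le (none :: w) x y) hΓ''b
    (by simpa [goodW] using (P.base_good hw1 hhalf_le).1)
    (by
      rw [hΓ''l]
      have := Nat.mul_le_mul hhalf_le (P.rB_le_rmax hw1')
      omega)
  have hg' := hg.weaken₂ (Γ'' ++ [P.goodW (none :: w)])
    (by
      intro C hC; simp only [List.mem_cons] at hC
      simp only [List.mem_append, List.mem_singleton, goodW, List.length_cons]
      rcases hC with rfl | hC
      · exact Or.inr rfl
      · exact Or.inl hC)
    (by
      intro C hC
      simp only [List.mem_append, List.mem_singleton, goodW, List.length_cons] at hC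
      simp only [List.mem_cons]
      rcases hC with hC | rfl
      · exact Or.inl (Or.inr hC)
      · exact Or.inl (Or.inl rfl))
    (by simp only [List.length_append, hΓ''l, List.length_cons, List.length_nil]; omega)
  refine (show Sq Q _ ((neg (P.goodW w) :: P.Γ) ++ (List.range P.h).map (P.lowW w) ++
    [P.goodW (none :: w)]) from hg').mono ?_
  have c1 := P.comps_le hhalf_le (P.rB_le_rmax hw1')
  have c2 : P.X ^ 11 + 3 * (half * rB P.h P.cG (w.length + 1)) + 4 ≤ P.X ^ 12 := by
    have := Nat.mul_le_mul hhalf_le (P.rB_le_rmax hw1')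
    have : 3 * (P.h * P.rmax) + 4 ≤ P.X ^ 5 := by
      have := P.xconst 2 (c := 4) (by norm_num)
      have : P.X ^ 2 + P.X ^ 2 ≤ P.X ^ 3 := P.xdbl 2
      have : P.X ^ 3 + P.X ^ 3 ≤ P.X ^ 4 := P.xdbl 3
      have : P.X ^ 4 + P.X ^ 4 ≤ P.X ^ 5 := P.xdbl 4
      omega
    have : P.X ^ 5 ≤ P.X ^ 11 := P.xpow_mono (by norm_num)
    have : P.X ^ 11 + P.X ^ 11 ≤ P.X ^ 12 := P.xdbl 11
    omega
  have c3 : (P.m + P.m * (P.m * (half * (rB P.h P.cG (w.length + 1) * rB P.h P.cG (w.length + 1))))) *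
      (P.X ^ 11 + 3 * (half * rB P.h P.cG (w.length + 1)) + 4) ≤ P.X ^ 20 := by
    calc _ ≤ P.gc * P.X ^ 12 := Nat.mul_le_mul c1 c2
      _ ≤ P.X ^ 8 * P.X ^ 12 := Nat.mul_le_mul_right _ P.gc_le
      _ = P.X ^ 20 := by ring
  have : P.X ^ 20 ≤ P.X ^ 21 := P.xpow_mono (by norm_num)
  have : 2 ≤ P.X ^ 21 := P.xconst 21 (by norm_num)
  have : P.X ^ 21 + P.X ^ 21 ≤ P.X ^ 22 := P.xdbl 21
  omega

/-- **The halving step**: if `R_w` is good then some `R_{c w}` is good. [cite: Krajicek2019, proof of Thm. 11.4.7] -/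
theorem step {w : List (Option ℕ)} (hℓ : w.length < P.e) :
    Sq Q (P.X ^ 29) ((neg (P.goodW w) :: P.Γ) ++ (letters P.h).map (fun c => P.goodW (c :: w))) := by
  have hX := P.hX2
  have hw : w.length ≤ P.e := hℓ.le
  set AllNew := (letters P.h).map (fun c => P.goodW (c :: w)) with hAll
  have hAllB : ∀ A ∈ AllNew, Base Q A := by
    intro A hA
    simp only [hAll, List.mem_map] at hA
    obtain ⟨c, _, rfl⟩ := hA
    simpa [goodW] using (P.base_good (w := c :: w) (by simp; omega) (P.nB_le_h _)).1
  have hAlll : AllNew.length = P.h + 1 := by simp [hAll, length_letters]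
  have hbg := P.base_good hw (P.nB_le_h w.length)
  have hW := P.hW'
  set Lows := (List.range P.h).map (P.lowW w) with hLows
  have s0 := (P.caseUp hℓ).weaken₂ (Lows ++ ((neg (P.goodW w) :: P.Γ) ++ AllNew))
    (by
      intro C hC
      simp only [List.mem_append, List.mem_cons, List.mem_nil_iff, or_false] at hC
      simp only [List.mem_append, List.mem_cons, hLows]
      rcases hC with ((rfl | hC) | hC) | rfl
      · exact Or.inr (Or.inl (Or.inl rfl))
      · exact Or.inr (Or.inl (Or.inr hC))
      · exact Or.inl hC
      · refine Or.inr (Or.inr ?_)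
        simp only [hAll, List.mem_map]
        exact ⟨none, none_mem_letters _, rfl⟩)
    (by
      intro C hC
      simp only [List.mem_append, List.mem_cons, hLows] at hC
      rcases hC with hC | (rfl | hC) | hC
      · exact Or.inl (by simp [hC])
      · exact Or.inl (by simp)
      · exact Or.inl (by simp [hC])
      · exact Or.inr (hAllB C hC))
    (by simp only [List.length_append, hLows, List.length_map, List.length_range, List.length_cons, hAlll]; omega)
  have s1 := Sq.multiCut Lows s0 (t' := P.X ^ 26 + 1) (by
    intro L hL
    simp only [hLows, List.mem_map, List.mem_range] at hL
    obtain ⟨i, hi, rfl⟩ := hL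
    refine (P.caseLow hℓ hi).weaken₂ _ ?_ ?_ ?_
    · intro C hC
      simp only [List.mem_cons, List.mem_append, List.mem_nil_iff, or_false] at hC
      simp only [List.mem_cons, List.mem_append]
      rcases hC with (rfl | rfl | hC) | rfl
      · exact Or.inl rfl
      · exact Or.inr (Or.inl (Or.inl rfl))
      · exact Or.inr (Or.inl (Or.inr hC))
      · refine Or.inr (Or.inr ?_)
        simp only [hAll, List.mem_map]
        exact ⟨some i, some_mem_letters hi, rfl⟩
    · intro C hC
      simp only [List.mem_cons, List.mem_append] at hC
      rcases hC with rfl | (rfl | hC) | hC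
      · exact Or.inl (by simp)
      · exact Or.inl (by simp)
      · exact Or.inl (by simp [hC])
      · exact Or.inr (hAllB C hC)
    · simp only [List.length_cons, List.length_append, hAlll]; omega)
  refine s1.mono ?_
  have hl : Lows.length = P.h := by simp [hLows]
  rw [hl]
  have a : P.X ^ 26 + 1 + 2 ≤ P.X ^ 27 := by
    have : 3 ≤ P.X ^ 26 := P.xconst 26 (by norm_num)
    have : P.X ^ 26 + P.X ^ 26 ≤ P.X ^ 27 := P.xdbl 26
    omega
  have b : P.h * (P.X ^ 26 + 1 + 2) ≤ P.X ^ 28 := by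
    calc _ ≤ P.X * P.X ^ 27 := Nat.mul_le_mul P.h_le_X a
      _ = P.X ^ 28 := by ring
  have : P.X ^ 22 + 1 ≤ P.X ^ 28 := by
    have : P.X ^ 22 ≤ P.X ^ 27 := P.xpow_mono (by norm_num)
    have : 1 ≤ P.X ^ 27 := Nat.one_le_pow _ _ (by omega)
    have : P.X ^ 27 + P.X ^ 27 ≤ P.X ^ 28 := P.xdbl 27
    omega
  have : P.X ^ 28 + P.X ^ 28 ≤ P.X ^ 29 := P.xdbl 28
  omega

/-- Auxiliary lemma `e_lt_h` (bounded-depth Frege toolkit / Pudlák–Krajíček construction, see the section header). [cite: Krajicek2019, proof of Thm. 11.4.7] -/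
theorem e_lt_h : P.e < P.h := by rw [P.hh]; exact Nat.lt_two_pow_self

/-- **The halving induction**: all goodness formulas of one level, disjunctively. [cite: Krajicek2019, proof of Thm. 11.4.7] -/
theorem levels : ∀ ℓ, ℓ ≤ P.e → Sq Q ((ℓ + 1) * P.X ^ 31) (P.Γ ++ (words P.h ℓ).map P.goodW)
  | 0, _ => by
    have hX := P.hX2
    have hW := P.hW'
    have hg := goodIntro (Q := Q) (R := P.G) (m := P.m) (n := P.h) (r := P.cG) (t := P.tG) (Γ' := P.Γ)
      P.hTot P.hDisj P.hcG P.hΓ (by simpa [HB.R, relB] using (P.base_good (w := []) (by simp) le_rfl).1)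
      (by omega)
    have hg' := hg.weaken₂ (P.Γ ++ [good P.G P.m P.h])
      (by intro C hC; simp only [List.mem_cons] at hC; simp only [List.mem_append, List.mem_singleton]; tauto)
      (by intro C hC; simp only [List.mem_append, List.mem_singleton] at hC; simp only [List.mem_cons]; tauto)
      (by simp; omega)
    have e1 : (words P.h 0).map P.goodW = [good P.G P.m P.h] := by
      simp [words, goodW, HB.R, relB, P.nB_zero]
    rw [e1]
    refine hg'.mono ?_
    have c1 := P.comps_le le_rfl (show P.cG ≤ P.rmax from by
      simpa [rB] using P.rB_le_rmax (Nat.zero_le _))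
    have c2 : P.tG + 3 * (P.h * P.cG) + 4 ≤ P.X ^ 5 := by
      have := P.hXt; have := P.hc_le
      have := P.xconst 2 (c := 4) (by norm_num)
      have : P.X ≤ P.X ^ 2 := xb_self hX 2 (by norm_num)
      have : P.X ^ 2 + P.X ^ 2 ≤ P.X ^ 3 := P.xdbl 2
      have : P.X ^ 3 + P.X ^ 3 ≤ P.X ^ 4 := P.xdbl 3
      have : P.X ^ 4 + P.X ^ 4 ≤ P.X ^ 5 := P.xdbl 4
      omega
    have c3 := Nat.mul_le_mul c1 c2
    have : P.gc * P.X ^ 5 ≤ P.X ^ 13 := by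
      calc _ ≤ P.X ^ 8 * P.X ^ 5 := Nat.mul_le_mul_right _ P.gc_le
        _ = P.X ^ 13 := by ring
    have : 2 ≤ P.X ^ 13 := P.xconst 13 (by norm_num)
    have : P.X ^ 13 + P.X ^ 13 ≤ P.X ^ 14 := P.xdbl 13
    have : P.X ^ 14 ≤ P.X ^ 31 := P.xpow_mono (by norm_num)
    omega
  | ℓ + 1, hℓ => by
    have hX := P.hX2
    have hW := P.hW'
    have ih := levels ℓ (by omega)
    set Lv := (words P.h ℓ).map P.goodW with hLv
    set Ln := (words P.h (ℓ + 1)).map P.goodW with hLn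
    have hLvl : Lv.length = (P.h + 1) ^ ℓ := by simp [hLv, length_words]
    have hLnl : Ln.length = (P.h + 1) ^ (ℓ + 1) := by simp [hLn, length_words]
    have hp1 : (P.h + 1) ^ ℓ ≤ (P.h + 1) ^ P.e := Nat.pow_le_pow_right (by omega) (by omega)
    have hp2 : (P.h + 1) ^ (ℓ + 1) ≤ (P.h + 1) ^ P.e := Nat.pow_le_pow_right (by omega) hℓ
    have hLnB : ∀ A ∈ Ln, Base Q A := by
      intro A hA
      simp only [hLn, List.mem_map] at hA
      obtain ⟨w, hw, rfl⟩ := hA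
      have hwl := mem_words_length hw
      exact (P.base_good (w := w) (by omega) (P.nB_le_h _)).1
    have s0 := ih.weaken₂ (Lv ++ (P.Γ ++ Ln))
      (by intro C hC; simp only [List.mem_append] at hC ⊢; tauto)
      (by
        intro C hC; simp only [List.mem_append] at hC ⊢
        rcases hC with hC | hC | hC
        · exact Or.inl (Or.inr hC)
        · exact Or.inl (Or.inl hC)
        · exact Or.inr (hLnB C hC))
      (by simp only [List.length_append, hLvl, hLnl]; omega)
    have s1 := Sq.multiCut Lv s0 (t' := P.X ^ 29 + 1) (by
      intro A hA
      simp only [hLv, List.mem_map] at hA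
      obtain ⟨w, hw, rfl⟩ := hA
      have hwl := mem_words_length hw
      refine (P.step (w := w) (by omega)).weaken₂ _ ?_ ?_ ?_
      · intro C hC
        simp only [List.mem_append, List.mem_cons, List.mem_map] at hC
        simp only [List.mem_cons, List.mem_append]
        rcases hC with (rfl | hC) | ⟨c, hc, rfl⟩
        · exact Or.inl rfl
        · exact Or.inr (Or.inl hC)
        · refine Or.inr (Or.inr ?_)
          simp only [hLn, List.mem_map]
          exact ⟨c :: w, cons_mem_words hc hw, rfl⟩
      · intro C hC
        simp only [List.mem_cons, List.mem_append] at hC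
        rcases hC with rfl | hC | hC
        · exact Or.inl (by simp)
        · exact Or.inl (by simp [hC])
        · exact Or.inr (hLnB C hC)
      · simp only [List.length_cons, List.length_append, hLnl]; omega)
    refine s1.mono ?_
    rw [hLvl]
    have a : P.X ^ 29 + 1 + 2 ≤ P.X ^ 30 := by
      have : 3 ≤ P.X ^ 29 := P.xconst 29 (by norm_num)
      have : P.X ^ 29 + P.X ^ 29 ≤ P.X ^ 30 := P.xdbl 29
      omega
    have b : (P.h + 1) ^ ℓ * (P.X ^ 29 + 1 + 2) + P.X ^ 30 ≤ P.X ^ 31 := by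
      have h1 : (P.h + 1) ^ ℓ * (P.X ^ 29 + 1 + 2) ≤ (P.h + 1) ^ ℓ * P.X ^ 30 :=
        Nat.mul_le_mul_left _ a
      have h2 : (P.h + 1) ^ ℓ * P.X ^ 30 + P.X ^ 30 = ((P.h + 1) ^ ℓ + 1) * P.X ^ 30 := by ring
      have hp3 : (P.h + 1) ^ ℓ < (P.h + 1) ^ (ℓ + 1) :=
        Nat.pow_lt_pow_right (by have := P.one_le_h; omega) (by omega)
      have h3 : ((P.h + 1) ^ ℓ + 1) * P.X ^ 30 ≤ P.X * P.X ^ 30 :=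
        Nat.mul_le_mul_right _ (by have := hp2.trans P.hXp; omega)
      have e : P.X * P.X ^ 30 = P.X ^ 31 := by ring
      omega
    have : 1 ≤ P.X ^ 30 := Nat.one_le_pow _ _ (by omega)
    have : P.X ^ 30 ≤ P.X ^ 31 := P.xpow_mono (by norm_num)
    have e2 : (ℓ + 1 + 1) * P.X ^ 31 = (ℓ + 1) * P.X ^ 31 + P.X ^ 31 := by ring
    omega

/-- **The weak pigeonhole principle for flat relations `[h²] → [h]`** (Paris–Wilkie–Woods;
Maciel–Pitassi–Woods; Krajíček 2019, Thm. 11.4.7): the hypotheses of `HB` are contradictory,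
i.e. the context `Γ` alone is derivable. [cite: Krajicek2019, proof of Thm. 11.4.7] -/
theorem wphp : Sq Q (P.X ^ 32) P.Γ := by
  have hX := P.hX2
  have hW := P.hW'
  have hl := P.levels P.e le_rfl
  have hm2 : 1 < P.m := by
    have := Nat.mul_le_mul P.two_le_h P.two_le_h; unfold m; omega
  have hm1 : 0 < P.m := by omega
  set Lw := (words P.h P.e).map P.goodW with hLw
  have hLwl : Lw.length = (P.h + 1) ^ P.e := by simp [hLw, length_words]
  have s0 := hl.weaken₂ (Lw ++ P.Γ)
    (by intro C hC; simp only [List.mem_append] at hC ⊢; tauto)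
    (by intro C hC; simp only [List.mem_append] at hC ⊢; tauto)
    (by simp only [List.length_append, hLwl]; omega)
  have s1 := Sq.multiCut Lw s0 (t' := P.X ^ 16) (by
    intro A hA
    simp only [hLw, List.mem_map] at hA
    obtain ⟨w, hw, rfl⟩ := hA
    have hwl := mem_words_length hw
    have hwe : w.length ≤ P.e := hwl.le
    have hn1 : P.nB w.length = 1 := by rw [hwl]; exact P.nB_e
    have hbg := P.base_good hwe (P.nB_le_h w.length)
    set K0 := P.R w 0 0 with hK0
    set K1 := P.R w 1 0 with hK1
    have hK0l : K0.length ≤ P.rmax := P.length_R_le' hwe 0 0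
    have hK1l : K1.length ≤ P.rmax := P.length_R_le' hwe 1 0
    have hrr : P.rmax ≤ P.h * P.rmax := Nat.le_mul_of_pos_left _ P.one_le_h
    have v0 := P.virt_tot hwe 0 hm1
    have v1 := P.virt_tot hwe 1 hm2
    rw [hn1] at v0 v1
    have a0 : Sq Q (P.X ^ 10 + 1) (K0 ++ (neg (P.goodW w) :: P.Γ)) := by
      refine v0.weaken₂ _ ?_ ?_ ?_
      · intro C hC
        simp only [List.mem_cons, List.mem_append, List.mem_flatMap, List.mem_range] at hC
        simp only [List.mem_append, List.mem_cons]
        rcases hC with (rfl | hC) | ⟨y, hy, hC⟩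
        · exact Or.inr (Or.inl rfl)
        · exact Or.inr (Or.inr hC)
        · have : y = 0 := by omega
          subst this; exact Or.inl hC
      · intro C hC
        simp only [List.mem_append, List.mem_cons] at hC
        rcases hC with hC | rfl | hC
        · exact Or.inr (P.base_chain hwe hC).1
        · exact Or.inl (by simp)
        · exact Or.inl (by simp [hC])
      · simp only [List.length_append, List.length_cons]; omega
    have a1 := Sq.multiCut K0 a0 (t' := P.X ^ 13) (by
      intro κ hκ
      have hbκ := P.base_chain hwe hκ
      have b0 : Sq Q (P.X ^ 10 + 1) (K1 ++ (neg κ :: neg (P.goodW w) :: P.Γ)) := by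
        refine v1.weaken₂ _ ?_ ?_ ?_
        · intro C hC
          simp only [List.mem_cons, List.mem_append, List.mem_flatMap, List.mem_range] at hC
          simp only [List.mem_append, List.mem_cons]
          rcases hC with (rfl | hC) | ⟨y, hy, hC⟩
          · exact Or.inr (Or.inr (Or.inl rfl))
          · exact Or.inr (Or.inr (Or.inr hC))
          · have : y = 0 := by omega
            subst this; exact Or.inl hC
        · intro C hC
          simp only [List.mem_append, List.mem_cons] at hC
          rcases hC with hC | rfl | rfl | hC
          · exact Or.inr (P.base_chain hwe hC).1
          · exact Or.inr hbκ.2.1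
          · exact Or.inl (by simp)
          · exact Or.inl (by simp [hC])
        · simp only [List.length_append, List.length_cons]; omega
      have b1 := Sq.multiCut K1 b0 (t' := P.X ^ 10 + 1) (by
        intro κ' hκ'
        have h01 := P.virt_disj hwe 0 hm1 1 hm2 (by norm_num) 0 (by rw [hn1]; norm_num) κ hκ κ' hκ'
        exact h01.swap)
      refine b1.mono ?_
      have : K1.length * (P.X ^ 10 + 1 + 2) ≤ P.X * (P.X ^ 10 + 1 + 2) :=
        Nat.mul_le_mul_right _ (hK1l.trans P.hXr)
      have : P.X * (P.X ^ 10 + 1 + 2) ≤ P.X ^ 12 := by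
        have : P.X ^ 10 + 1 + 2 ≤ P.X ^ 11 := by
          have : 3 ≤ P.X ^ 10 := P.xconst 10 (by norm_num)
          have : P.X ^ 10 + P.X ^ 10 ≤ P.X ^ 11 := P.xdbl 10
          omega
        calc _ ≤ P.X * P.X ^ 11 := Nat.mul_le_mul_left _ this
          _ = P.X ^ 12 := by ring
      have : P.X ^ 10 + 1 ≤ P.X ^ 12 := by
        have : P.X ^ 10 ≤ P.X ^ 11 := P.xpow_mono (by norm_num)
        have : 1 ≤ P.X ^ 11 := Nat.one_le_pow _ _ (by omega)
        have : P.X ^ 11 + P.X ^ 11 ≤ P.X ^ 12 := P.xdbl 11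
        omega
      have : P.X ^ 12 + P.X ^ 12 ≤ P.X ^ 13 := P.xdbl 12
      omega)
    refine a1.mono ?_
    have : K0.length * (P.X ^ 13 + 2) ≤ P.X * (P.X ^ 13 + 2) :=
      Nat.mul_le_mul_right _ (hK0l.trans P.hXr)
    have : P.X * (P.X ^ 13 + 2) ≤ P.X ^ 15 := by
      have : P.X ^ 13 + 2 ≤ P.X ^ 14 := by
        have : 2 ≤ P.X ^ 13 := P.xconst 13 (by norm_num)
        have : P.X ^ 13 + P.X ^ 13 ≤ P.X ^ 14 := P.xdbl 13
        omega
      calc _ ≤ P.X * P.X ^ 14 := Nat.mul_le_mul_left _ this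
        _ = P.X ^ 15 := by ring
    have : P.X ^ 10 + 1 ≤ P.X ^ 15 := by
      have : P.X ^ 10 ≤ P.X ^ 14 := P.xpow_mono (by norm_num)
      have : 1 ≤ P.X ^ 14 := Nat.one_le_pow _ _ (by omega)
      have : P.X ^ 14 + P.X ^ 14 ≤ P.X ^ 15 := P.xdbl 14
      omega
    have : P.X ^ 15 + P.X ^ 15 ≤ P.X ^ 16 := P.xdbl 15
    omega)
  refine s1.mono ?_
  rw [hLwl]
  have a : (P.h + 1) ^ P.e * (P.X ^ 16 + 2) ≤ P.X ^ 18 := by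
    have : P.X ^ 16 + 2 ≤ P.X ^ 17 := by
      have : 2 ≤ P.X ^ 16 := P.xconst 16 (by norm_num)
      have : P.X ^ 16 + P.X ^ 16 ≤ P.X ^ 17 := P.xdbl 16
      omega
    calc _ ≤ P.X * P.X ^ 17 := Nat.mul_le_mul P.hXp this
      _ = P.X ^ 18 := by ring
  have b : P.X ^ 18 + 1 ≤ P.X ^ 31 := by
    have : P.X ^ 18 ≤ P.X ^ 30 := P.xpow_mono (by norm_num)
    have : 1 ≤ P.X ^ 30 := Nat.one_le_pow _ _ (by omega)
    have : P.X ^ 30 + P.X ^ 30 ≤ P.X ^ 31 := P.xdbl 30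
    omega
  have c : (P.e + 1) * P.X ^ 31 + P.X ^ 31 ≤ P.X ^ 32 := by
    have he : P.e + 2 ≤ P.X := by have := P.e_lt_h; have := P.hXh; omega
    calc (P.e + 1) * P.X ^ 31 + P.X ^ 31 = (P.e + 2) * P.X ^ 31 := by ring
      _ ≤ P.X * P.X ^ 31 := Nat.mul_le_mul_right _ he
      _ = P.X ^ 32 := by ring
  omega

end HB


end DepthFrege

end Literature.Computability.MetaComplexity
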